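import Summits.ValiantsHypothesis.ValiantsHypothesis.Theorems.DepthWindowHomImmHardBDS
import Summits.ValiantsHypothesis.ValiantsHypothesis.Theorems.DepthWindowHomImmHardLt
import Summits.ValiantsHypothesis.ValiantsHypothesis.Theorems.DepthWindowHomRelTwoMul
import HarnessLib

/-!
# Route `DepthWindow`, g11 — DUALITY HALVING: the homogenisation coordinate of the dial is closed

Workshop `decomp-valiant`, lens 4 ("depth-reduction / chasm axis"), generation 11.  Tags (workshop
output contract): every `def` below is a problem-side Prop and carries `@[conjecture]`; nothing is
asserted; every `theorem` is proved (0 sorry).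

## The observation (T2, "duality halving")

Gupta–Kamath–Kayal–Saptharishi's depth-three chasm (SIAM J. Comput. 45 (2016), §4: Fischer's identity
Lemma 4.3/4.4, Saxena's duality Lemma 4.6, univariate factoring over `ℂ` Lemma 4.7 — all PROVED in the
tree, `Literature/…/DepthThreeChasmAlgebra.lean`, `DepthThreeChasmGKKSProofs.lean`: `fischer_ryser`,
`saxena_duality`, `IsSPS.aeval`, `isSPS_prod_lowdeg`) turns a HOMOGENEOUS `ΠΣΠ` block of product fan-ins
`≤ d` over arbitrary inputs `z` into a `ΣΠ(affine forms in z)` block: TWO homogeneous product layers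
become ONE inhomogeneous product layer, at cost `poly(s) · 2^{O(d)}` (sparsity-aware count).  Applied
to the consecutive pairs of product layers of an every-gate-homogeneous circuit (after the syntactic
normalisation "a homogeneous-valued sum gate equals the sum of its operands of the right degree") it
gives, over `ℂ` and in the tree's unbounded-fan-in model (`size` = gates, `productDepth`):

  `DualityHalvingAt b` : hom. product-depth `Δ`, size `s`, degree `d`  ⟹  product-depth `⌈Δ/2⌉`,
                         size `≤ (s + |σ| + 2)^b · 2^{b d}`.

It is typed here as a `@[conjecture]` Prop (THEOREM-INPUT, PROVABLE-NOW from the cited tree lemmas;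
the port is the sparsity-aware `isSPS_pow` + block surgery) and used only as a hypothesis.
Print: the case `Δ = 2` over variables is GKKS Thm 1.1's last two steps; Limaye–Srinivasan–Tavenas
(J. ACM 72 (2025) = FOCS 2021), remark after Cor. 4: "In the case `Δ = 1`, our bound is actually
tight, by a beautiful upper bound due to [GKKS]"; Kayal–Saha, *Lower bounds for depth three arithmetic
circuits with small bottom fanin* (ToC 12 (2016)), Lemma 5 ("implicit in [SW99] and [GKKS13a]") for the
two directions `ΣΠΣ ↔ hom ΣΠΣΠΣ`.  The blockwise statement for general `Δ` is the one-paragraph corollary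
"substitute gate values for variables"; no verbatim print statement was found (planner presearch, g11).

## Consequences for the route (all mod T2, kernel below)

Write `Hard(σ) = HomImmHardAt p q` (`σ = p/q`), `Hom(σ) = HomAtSlope p q`, `L₃ = log₂log₂log₂`.

1. `ImmHardAt p q` (NO homogeneity: circuits of product-depth `≤ ⌊σ L₃ m⌋ + c` for
   `IMM_{m,⌊√log₂ m⌋}` have `> m^c + c` gates) satisfies
   `HomImmHardAt (2p) q → ImmHardAt p q` (KERNEL, via LST Lemma 11 = `homAtSlope_two_one`) and
   `ImmHardAt p q → HomImmHardAt (2p) q` (mod T2): **inhomogeneous depth `Δ` ≡ homogeneous depth `2Δ`**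
   in the dial's regime.  The A-crux for `IMM` is ONE cell: `ImmHardAt 1 1 ≡ Hard(2)`.
2. (companion file `DepthWindowImmHardTransport.lean`, KERNEL) `ImmHardAt 1 1 → PerHardLog3`
   (projection transport only; no homogenisation).
3. DOMINANCE (mod T2): `HomAt p q c₀ a ∧ Hard(p/q) ⟹ Hard(2)` for EVERY slope — so the g5 split
   `HomSubReach ∧ HomImmHardSubReach` never bought anything beyond `Hard(2)`:
   `homImmHardAt_two_one_of_homSubReach : DualityHalving → HomSubReach → HomImmHardAt 2 1`, while
   `HomImmHardAt 2 1 → PerHardLog3` is already kernel (`perHardLog3_of_homImmHardAt_two_one`, g8).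
   (The uniform crux `HomSubReach` is moreover FALSE mod T2 by self-improvement — iterate
   "halve, then re-homogenise at slope `< 2`" from the `⌈log₂ d⌉`-depth circuit of `IMM` down to
   constant product-depth at quasi-polynomial size, against `homLst_geom_solved`; planner note, not
   typed here.)
4. (companion file) print-range completion of the hard column, consumer of lens 2's `homBds_slope`:
   `homImmHardAt_of_le_36_25 : 25 p ≤ 36 q → HomImmHardAt p q` (BDS 2024 for every `σ ≤ 1.44`).

[cite: GuptaKamathKayalSaptharishi2016, Lemma 4.3, Lemma 4.6, Lemma 4.7]
[cite: LimayeSrinivasanTavenas2025, Lemma 11, Cor. 4] [cite: BhargavDuttaSaxena2024, Thm. 1.4, Rem. 1.5]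
[cite: Valiant1979]
-/

-- layout Summits/ValiantsHypothesis/ValiantsHypothesis forces the duplicated namespace component
set_option linter.dupNamespace false

namespace Summit.ValiantsHypothesis.ValiantsHypothesis.Theorems.DepthWindow

open MvPolynomial Literature.Computability.AlgebraicComplexity ArithCircuit
open Summit.ValiantsHypothesis.ValiantsHypothesis.Theses.DepthWindow

noncomputable section

/-! ### The theorem-input and the inhomogeneous dial -/

/-- **Duality halving with exponent `b`** (T2): over `ℂ`, every every-gate-homogeneous circuit of
product-depth `Δ` and `s` gates computing a degree-`d` homogeneous `f` over the variables `σ` can be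
replaced by a circuit (not necessarily homogeneous) computing `f` of product-depth `≤ ⌈Δ/2⌉` with at most
`(s + |σ| + 2)^b · 2^{b d}` gates.  Blockwise Fischer identity + Saxena duality + univariate factoring
(GKKS 2016 §4); PROVABLE-NOW from `DepthThreeChasmGKKSProofs.isSPS_prod_lowdeg` (sparsity-aware).
[cite: GuptaKamathKayalSaptharishi2016, Lemma 4.3, Lemma 4.6, Lemma 4.7] -/
@[conjecture] def DualityHalvingAt (b : ℕ) : Prop :=
  ∀ (σ : Type) [Fintype σ] (d : ℕ) (f : MvPolynomial σ ℂ), f.IsHomogeneous d →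
    ∀ D : ArithCircuit ℂ σ, (∀ g ∈ ArithCircuit.gateValues D.gates, ∃ e : ℕ, g.IsHomogeneous e) →
      D.Computes f → ∃ D' : ArithCircuit ℂ σ,
        D'.Computes f ∧ D'.productDepth ≤ (D.productDepth + 1) / 2 ∧
        D'.size ≤ (D.size + Fintype.card σ + 2) ^ b * 2 ^ (b * d)

/-- **Duality halving** (T2) for some exponent. [cite: GuptaKamathKayalSaptharishi2016, Lemma 4.6] -/
@[conjecture] def DualityHalving : Prop := ∃ b : ℕ, DualityHalvingAt b

/-- **Inhomogeneous hardness of `IMM` at depth slope `p/q`**: for every `c`, from some `m₀` on, every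
circuit (no homogeneity assumption) of product-depth `≤ ⌊p ⌊log₂⌊log₂⌊log₂ m⌋⌋⌋/q⌋ + c` computing
`IMM_{m,⌊√⌊log₂ m⌋⌋}` over `ℂ` has more than `m^c + c` gates.  `ImmHardAt 1 1` is the `IMM` version of
the route crux `PerHardLog3`. [cite: LimayeSrinivasanTavenas2025, Cor. 4] -/
@[conjecture] def ImmHardAt (p q : ℕ) : Prop :=
  ∀ c : ℕ, ∃ m₀ : ℕ, ∀ m : ℕ, m₀ ≤ m →
    ∀ D : ArithCircuit ℂ (Fin (Nat.sqrt (Nat.log 2 m)) × Fin m × Fin m),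
      D.Computes (immPoly m (Nat.sqrt (Nat.log 2 m)) ℂ) →
      D.productDepth ≤ p * Nat.log 2 (Nat.log 2 (Nat.log 2 m)) / q + c → m ^ c + c < D.size

/-! ### Arithmetic -/

/-- `|Fin d × Fin m × Fin m| ≤ m³ + 3` at `d = ⌊√⌊log₂ m⌋⌋`. [folklore] -/
private theorem card_immVars_le (m : ℕ) :
    Fintype.card (Fin (Nat.sqrt (Nat.log 2 m)) × Fin m × Fin m) ≤ m ^ 3 + 3 := by
  simp only [Fintype.card_prod, Fintype.card_fin]
  have hd : Nat.sqrt (Nat.log 2 m) ≤ m := (Nat.sqrt_le_self _).trans (Nat.log_le_self 2 m)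
  calc Nat.sqrt (Nat.log 2 m) * (m * m) ≤ m * (m * m) := Nat.mul_le_mul_right _ hd
    _ = m ^ 3 := by ring
    _ ≤ m ^ 3 + 3 := Nat.le_add_right _ _

/-- `2 ^ (a e) ≤ m ^ a + a` whenever `e ≤ ⌊log₂ m⌋`. [folklore] -/
private theorem two_pow_mul_le_pow_add {a e m : ℕ} (he : e ≤ Nat.log 2 m) : 2 ^ (a * e) ≤ m ^ a + a := by
  rcases Nat.eq_zero_or_pos m with rfl | hm
  · have : e = 0 := by simpa using he
    subst this
    rcases a with _ | a <;> simp
  · calc 2 ^ (a * e) ≤ 2 ^ (a * Nat.log 2 m) := Nat.pow_le_pow_right (by norm_num) (Nat.mul_le_mul_left a he)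
      _ = (2 ^ Nat.log 2 m) ^ a := by rw [mul_comm, pow_mul]
      _ ≤ m ^ a := Nat.pow_le_pow_left (Nat.pow_log_le_self 2 hm.ne') a
      _ ≤ m ^ a + a := Nat.le_add_right _ _

/-- `2 ^ (a d d) ≤ m ^ a + a` at `d = ⌊√⌊log₂ m⌋⌋`. [folklore] -/
private theorem two_pow_mul_sqrt_log_sq_le' (a m : ℕ) :
    2 ^ (a * Nat.sqrt (Nat.log 2 m) * Nat.sqrt (Nat.log 2 m)) ≤ m ^ a + a := by
  rw [mul_assoc]; exact two_pow_mul_le_pow_add (Nat.sqrt_le _)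

/-- `2 ^ (b d) ≤ m ^ b + b` at `d = ⌊√⌊log₂ m⌋⌋`. [folklore] -/
private theorem two_pow_mul_sqrt_log_le_lin (b m : ℕ) : 2 ^ (b * Nat.sqrt (Nat.log 2 m)) ≤ m ^ b + b :=
  two_pow_mul_le_pow_add (Nat.sqrt_le_self _)

/-- `⌊p (Y + e)/q⌋ ≤ ⌊p Y/q⌋ + p e` (also for `q = 0`). [folklore] -/
private theorem slope_add_le (p q Y e : ℕ) : p * (Y + e) / q ≤ p * Y / q + p * e := by
  rcases Nat.eq_zero_or_pos q with rfl | hq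
  · simp
  · calc p * (Y + e) / q = (p * Y + p * e) / q := by rw [mul_add]
      _ ≤ (p * Y + p * e * q) / q :=
          Nat.div_le_div_right (Nat.add_le_add_left (Nat.le_mul_of_pos_right _ hq) _)
      _ = p * Y / q + p * e := Nat.add_mul_div_right _ _ hq

/-- `⌊(⌊2pY/q⌋ + e)/2⌋ ≤ ⌊pY/q⌋ + e` (also for `q = 0`). [folklore] -/
private theorem half_two_mul_slope_le (p q Y e : ℕ) : (2 * p * Y / q + e) / 2 ≤ p * Y / q + e := by
  have h1 : 2 * p * Y / q / 2 = p * Y / q := by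
    rw [Nat.div_div_eq_div_mul, mul_assoc, mul_comm q 2]
    exact Nat.mul_div_mul_left _ _ (by norm_num)
  calc (2 * p * Y / q + e) / 2 ≤ (2 * p * Y / q + e * 2) / 2 :=
        Nat.div_le_div_right (Nat.add_le_add_left (Nat.le_mul_of_pos_right _ (by norm_num)) _)
    _ = 2 * p * Y / q / 2 + e := Nat.add_mul_div_right _ _ (by norm_num)
    _ = p * Y / q + e := by rw [h1]

/-- `2 ⌊pY/q⌋ ≤ ⌊2pY/q⌋`. [folklore] -/
private theorem two_mul_slope_le (p q Y : ℕ) : 2 * (p * Y / q) ≤ 2 * p * Y / q := by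
  rw [mul_assoc]; exact Nat.mul_div_le_mul_div_assoc _ _ _

/-- A polynomially bounded quantity that is at most `m^B + B` is at most `m^{c'} + c'` for `B ≤ c'`,
`1 ≤ m`. [folklore] -/
private theorem pow_add_mono {m B c' : ℕ} (hm : 1 ≤ m) (h : B ≤ c') : m ^ B + B ≤ m ^ c' + c' :=
  Nat.add_le_add (Nat.pow_le_pow_right hm h) h

/-! ### 1. Inhomogeneous depth `Δ` ≡ homogeneous depth `2Δ` -/

/-- **`Hard(2σ)` gives inhomogeneous hardness at slope `σ`** (KERNEL; LST Lemma 11 via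
`homAtSlope_two_one`): homogenise a shallow inhomogeneous circuit at rate `2` and apply the homogeneous
hardness at the doubled depth. [cite: LimayeSrinivasanTavenas2025, Lemma 11] -/
theorem immHardAt_of_homImmHardAt_two_mul {p q : ℕ} (hR : HomImmHardAt (2 * p) q) : ImmHardAt p q := by
  classical
  intro c
  obtain ⟨c₀, a, hH⟩ := homAtSlope_two_one
  obtain ⟨B, hB⟩ : IsPBounded fun m => ((m ^ c + c) + (m ^ 3 + 3) + 2) ^ a * (m ^ a + a) :=
    IsPBounded.mul_holds
      (IsPBounded.pow_holds (IsPBounded.add_holds (IsPBounded.add_holds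
        ⟨c, fun m => le_rfl⟩ ⟨3, fun m => le_rfl⟩) (IsPBounded.const 2)) a)
      ⟨a, fun m => le_rfl⟩
  obtain ⟨m₀, hm₀⟩ := hR (2 * c + c₀ + B + 1)
  refine ⟨max m₀ 1, fun m hm D hDc hDd => ?_⟩
  have hm0 : m₀ ≤ m := le_of_max_le_left hm
  have hm1 : 1 ≤ m := le_of_max_le_right hm
  by_contra hs
  rw [not_lt] at hs
  obtain ⟨D₂, hD₂c, hD₂h, hD₂d, hD₂s⟩ :=
    hH _ _ _ (immPoly_isHomogeneous_holds (k := ℂ) m _) D hDc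
  have hdepth : D₂.productDepth ≤
      2 * p * Nat.log 2 (Nat.log 2 (Nat.log 2 m)) / q + (2 * c + c₀ + B + 1) := by
    have h1 : 2 * D.productDepth / 1 ≤ 2 * (p * Nat.log 2 (Nat.log 2 (Nat.log 2 m)) / q) + 2 * c := by
      rw [Nat.div_one]; have := Nat.mul_le_mul_left 2 hDd; rw [mul_add] at this; exact this
    have h2 := two_mul_slope_le p q (Nat.log 2 (Nat.log 2 (Nat.log 2 m)))
    omega
  have hlt := hm₀ m hm0 D₂ hD₂h hD₂c hdepth
  have hsz : D₂.size ≤ m ^ B + B := by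
    refine hD₂s.trans ((?_ : _ ≤ _).trans (hB m))
    exact Nat.mul_le_mul
      (Nat.pow_le_pow_left (by have := card_immVars_le m; omega) _)
      (two_pow_mul_sqrt_log_sq_le' a m)
  have hmono : m ^ B + B ≤ m ^ (2 * c + c₀ + B + 1) + (2 * c + c₀ + B + 1) := pow_add_mono hm1 (by omega)
  omega

/-- **Inhomogeneous hardness at slope `σ` gives `Hard(2σ)`, mod duality halving**: halve a shallow
homogeneous circuit and apply the inhomogeneous hardness at half the depth.
[cite: GuptaKamathKayalSaptharishi2016, Lemma 4.6] [cite: LimayeSrinivasanTavenas2025, Cor. 4] -/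
theorem homImmHardAt_two_mul_of_immHardAt {b p q : ℕ} (hT : DualityHalvingAt b) (hI : ImmHardAt p q) :
    HomImmHardAt (2 * p) q := by
  classical
  intro c
  obtain ⟨B, hB⟩ : IsPBounded fun m => ((m ^ c + c) + (m ^ 3 + 3) + 2) ^ b * (m ^ b + b) :=
    IsPBounded.mul_holds
      (IsPBounded.pow_holds (IsPBounded.add_holds (IsPBounded.add_holds
        ⟨c, fun m => le_rfl⟩ ⟨3, fun m => le_rfl⟩) (IsPBounded.const 2)) b)
      ⟨b, fun m => le_rfl⟩
  obtain ⟨m₀, hm₀⟩ := hI (c + 1 + B)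
  refine ⟨max m₀ 1, fun m hm D hDh hDc hDd => ?_⟩
  have hm0 : m₀ ≤ m := le_of_max_le_left hm
  have hm1 : 1 ≤ m := le_of_max_le_right hm
  by_contra hs
  rw [not_lt] at hs
  obtain ⟨D₁, hD₁c, hD₁d, hD₁s⟩ :=
    hT _ _ _ (immPoly_isHomogeneous_holds (k := ℂ) m _) D hDh hDc
  have hdepth : D₁.productDepth ≤ p * Nat.log 2 (Nat.log 2 (Nat.log 2 m)) / q + (c + 1 + B) := by
    have h1 : (D.productDepth + 1) / 2 ≤
        (2 * p * Nat.log 2 (Nat.log 2 (Nat.log 2 m)) / q + (c + 1)) / 2 :=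
      Nat.div_le_div_right (by omega)
    have h2 := half_two_mul_slope_le p q (Nat.log 2 (Nat.log 2 (Nat.log 2 m))) (c + 1)
    omega
  have hlt := hm₀ m hm0 D₁ hD₁c hdepth
  have hsz : D₁.size ≤ m ^ B + B := by
    refine hD₁s.trans ((?_ : _ ≤ _).trans (hB m))
    exact Nat.mul_le_mul
      (Nat.pow_le_pow_left (by have := card_immVars_le m; omega) _)
      (two_pow_mul_sqrt_log_le_lin b m)
  have hmono : m ^ B + B ≤ m ^ (c + 1 + B) + (c + 1 + B) := pow_add_mono hm1 (by omega)
  omega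

/-- **The A-cell in two currencies** (mod T2): `ImmHardAt p q ↔ HomImmHardAt (2p) q`.
[cite: GuptaKamathKayalSaptharishi2016, Lemma 4.6] [cite: LimayeSrinivasanTavenas2025, Lemma 11] -/
theorem immHardAt_iff_homImmHardAt_two_mul {b p q : ℕ} (hT : DualityHalvingAt b) :
    ImmHardAt p q ↔ HomImmHardAt (2 * p) q :=
  ⟨homImmHardAt_two_mul_of_immHardAt hT, immHardAt_of_homImmHardAt_two_mul⟩

/-- The kernel half of the inhomogeneous dial: `ImmHardAt p q` for `10 p ≤ 7 q` (BDS at the doubled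
slope `≤ 7/5`). [cite: BhargavDuttaSaxena2024, Thm. 1.4, Rem. 1.5] [cite: LimayeSrinivasanTavenas2025, Lemma 11] -/
theorem immHardAt_of_ten_mul_le (p q : ℕ) (h : 10 * p ≤ 7 * q) : ImmHardAt p q :=
  immHardAt_of_homImmHardAt_two_mul (homImmHardAt_of_five_mul_le (2 * p) q (by omega))

/-! ### 3. Dominance: homogenisation below slope 2 never buys more than `Hard(2)` -/

/-- **Dominance** (mod T2): homogenisation at slope `p/q` together with homogeneous hardness at the
SAME slope gives `Hard(2)` — halve the given depth-`2L₃` homogeneous circuit, re-homogenise at slope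
`p/q`, and apply `Hard(p/q)`.  Holds verbatim for `q = 0` (constant-depth homogenisation).
[cite: GuptaKamathKayalSaptharishi2016, Lemma 4.6] [cite: LimayeSrinivasanTavenas2025, Lemma 11] -/
theorem homImmHardAt_two_one_of_homAt_hardAt {b p q c₀ a : ℕ} (hT : DualityHalvingAt b)
    (hH : HomAt p q c₀ a) (hR : HomImmHardAt p q) : HomImmHardAt 2 1 := by
  classical
  intro c
  obtain ⟨B, hB⟩ : IsPBounded fun m =>
      ((((m ^ c + c) + (m ^ 3 + 3) + 2) ^ b * (m ^ b + b)) + (m ^ 3 + 3) + 2) ^ a * (m ^ a + a) :=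
    IsPBounded.mul_holds
      (IsPBounded.pow_holds (IsPBounded.add_holds (IsPBounded.add_holds
        (IsPBounded.mul_holds
          (IsPBounded.pow_holds (IsPBounded.add_holds (IsPBounded.add_holds
            ⟨c, fun m => le_rfl⟩ ⟨3, fun m => le_rfl⟩) (IsPBounded.const 2)) b)
          ⟨b, fun m => le_rfl⟩)
        ⟨3, fun m => le_rfl⟩) (IsPBounded.const 2)) a)
      ⟨a, fun m => le_rfl⟩
  set c' : ℕ := p * ((c + 1) / 2) + c₀ + B + 1 with hc'
  obtain ⟨m₀, hm₀⟩ := hR c'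
  refine ⟨max m₀ 1, fun m hm D hDh hDc hDd => ?_⟩
  have hm0 : m₀ ≤ m := le_of_max_le_left hm
  have hm1 : 1 ≤ m := le_of_max_le_right hm
  by_contra hs
  rw [not_lt] at hs
  -- halve
  obtain ⟨D₁, hD₁c, hD₁d, hD₁s⟩ :=
    hT _ _ _ (immPoly_isHomogeneous_holds (k := ℂ) m _) D hDh hDc
  -- re-homogenise at slope p/q
  obtain ⟨D₂, hD₂c, hD₂h, hD₂d, hD₂s⟩ :=
    hH _ _ _ (immPoly_isHomogeneous_holds (k := ℂ) m _) D₁ hD₁c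
  set L3 := Nat.log 2 (Nat.log 2 (Nat.log 2 m)) with hL3
  have hD₁d' : D₁.productDepth ≤ L3 + (c + 1) / 2 := by
    have h1 : (D.productDepth + 1) / 2 ≤ (c + 1 + 2 * L3) / 2 := by
      refine Nat.div_le_div_right ?_
      rw [Nat.div_one] at hDd; omega
    rw [Nat.add_mul_div_left _ _ (by norm_num : 0 < 2)] at h1
    omega
  have hdepth : D₂.productDepth ≤ p * L3 / q + c' := by
    have h1 : p * D₁.productDepth / q ≤ p * (L3 + (c + 1) / 2) / q :=
      Nat.div_le_div_right (Nat.mul_le_mul_left p hD₁d')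
    have h2 := slope_add_le p q L3 ((c + 1) / 2)
    omega
  have hlt := hm₀ m hm0 D₂ hD₂h hD₂c hdepth
  have hcard := card_immVars_le m
  have hsz1 : D₁.size ≤ ((m ^ c + c) + (m ^ 3 + 3) + 2) ^ b * (m ^ b + b) :=
    hD₁s.trans (Nat.mul_le_mul (Nat.pow_le_pow_left (by omega) _) (two_pow_mul_sqrt_log_le_lin b m))
  have hsz : D₂.size ≤ m ^ B + B := by
    refine hD₂s.trans ((?_ : _ ≤ _).trans (hB m))
    exact Nat.mul_le_mul (Nat.pow_le_pow_left (by omega) _) (two_pow_mul_sqrt_log_sq_le' a m)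
  have hmono : m ^ B + B ≤ m ^ c' + c' := pow_add_mono hm1 (by omega)
  omega

/-- **The route crux is dominated** (mod T2): `HomSubReach` (homogenisation at some slope `≤ 7/5`)
already implies `Hard(2) = HomImmHardAt 2 1`, whose consequence `PerHardLog3` is kernel
(`perHardLog3_of_homImmHardAt_two_one`).  The hard half at slope `≤ 7/5` used inside is the closed
support item (`homImmHardAt_of_five_mul_le`, BDS). [cite: BhargavDuttaSaxena2024, Thm. 1.4, Rem. 1.5]
[cite: GuptaKamathKayalSaptharishi2016, Lemma 4.6] -/
theorem homImmHardAt_two_one_of_homSubReach (hT : DualityHalving) (hA1 : HomSubReach) :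
    HomImmHardAt 2 1 := by
  obtain ⟨b, hT⟩ := hT
  obtain ⟨p, q, c₀, a, hpq, hH⟩ := hA1
  exact homImmHardAt_two_one_of_homAt_hardAt hT hH (homImmHardAt_of_five_mul_le p q hpq)

/-- Hence (mod T2) the crux `HomSubReach` implies the `IMM` version of `PerHardLog3`.
[cite: GuptaKamathKayalSaptharishi2016, Lemma 4.6] -/
theorem immHardAt_one_one_of_homSubReach (hT : DualityHalving) (hA1 : HomSubReach) : ImmHardAt 1 1 :=
  immHardAt_of_homImmHardAt_two_mul (p := 1) (q := 1)
    (by simpa using homImmHardAt_two_one_of_homSubReach hT hA1)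

/-- Any homogenisation slope whatsoever, met by hardness at the same slope, factors through `Hard(2)`
(mod T2) before reaching the crux: the dial law `perHardLog3_of_slopeRate` loses nothing by being
read at `σ = 2`. [cite: LimayeSrinivasanTavenas2025, Lemma 11] -/
theorem perHardLog3_of_slopeRate_via_two {b p q : ℕ} (hT : DualityHalvingAt b) (hHom : HomAtSlope p q)
    (hHard : HomImmHardAt p q) : PerHardLog3 := by
  obtain ⟨c₀, a, hH⟩ := hHom
  exact perHardLog3_of_homImmHardAt_two_one (homImmHardAt_two_one_of_homAt_hardAt hT hH hHard)

end

end Summit.ValiantsHypothesis.ValiantsHypothesis.Theorems.DepthWindow
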